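import Summits.ResolutionOfSingularities.ResolutionOfSingularities.Theorems.PurelyInseparableDim4ScopeTrapCert
import Summits.ResolutionOfSingularities.ResolutionOfSingularities.Theorems.PurelyInseparableDim4LoopCLocalEscape
import HarnessLib

/-!
# The KILL-CERTIFICATE FORMAT for the LOCAL game (and any reply class) ‖ K: `classTrapB` / `localTrapB`
# (cell `res-dim4-pi`, seat res-dim4-p-8 g2, desk WORD #56 (a)(3); over res-dim4-p-6 g2's reply-class games
# `LoopCLocal.RSucc` / `RWins` / `localB` of `…LoopCLocalEscape` p663219, to be re-pointed at res-dim4-p-13's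
# `EdgeLoc` / `TerminatesInScopeLoc` when `…ScopeLocalGame` lands)

[OURS · counted 0 · instrument] Nothing here is a statement about resolution of singularities; resolution in
dimension `≥ 4` / characteristic `p > 0` is NOT proved or refuted by anything in this file, and NO trap is
exhibited here — the file is the FORMAT a found LOCAL (or class-restricted) B-region must be delivered in.

`…ScopeTrapCert` (`LoopC.scopeTrapB`) certifies an IN-SCOPE TRAP of the GLOBAL game (`Edge`: B may move along
the centre).  Here the recorded moves of the table are additionally required to lie in a reply class
`ρ S j b` — for the LOCAL game `ρ = LoopCLocal.localB` («`bᵢ = 0` off the centre», the `b`-side of `EdgeLoc`):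

* `classTrapB q ρ T` `= scopeTrapB q T ∧ every recorded move (S, j, b, _) has ρ S j b`; `localTrapB q T`.
* `rSucc_of_moveB` — a recorded legal move in the class is an `RSucc q ρ` edge into the table;
  **`isTrapSet_of_classTrapB`** — the table presents a `Game.IsTrapSet` (res-dim4-p-14) of the `ρ`-restricted
  in-scope game (legal = in scope ∧ permissible; every legal centre answered inside, the point always legal);
  **`not_rWins_of_classTrapB`** — no state of the table is an A-win of the `ρ`-game (`LoopCLocal.RWins`), by
  p-14's `Game.Wins.not_mem_of_isTrapSet`; **`not_terminatesInScope_of_classTrapB`** — and F4-C of record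
  (GLOBAL `TerminatesInScope p q`) fails too (a class trap is a trap: `LoopC.not_terminatesInScope_of_scopeTrapB`;
  equivalently p-6 g2's `forall_rWins_of_terminatesInScope`); LOCAL specialisations `…_of_localTrapB`.

So a surviving root of a LOCAL greatest-fixed-point hunt (crit-1 kit j317088 «crit1-trap33», local runs; any
engine) becomes `¬ RWins q localB s` for its states — the state-level negation of local in-scope termination —
by DATA ALONE: `def T : ScopeTrapRows (ZMod 3)` + `theorem : localTrapB 3 T = true := by decide +kernel`.
(res-dim4-p-6 g2's one-state regions P₁/P/Q answer the CROSSING-LINE centre only — a rule-class negative, not a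
local trap: A escapes P₁ by a plane, crit-1 l.1831.)
bears_on: LADDER-RESOLUTION:D157-DOOR2 (res-dim4-pi · F4-C-loc(3,3) decision · kill-certificate format).
Supports stmt-ResolutionOfSingularities-16155 (helper).
-/

set_option linter.dupNamespace false -- mandated namespace of this single-conjunct summit

noncomputable section

open MvPolynomial Finset

namespace Summit.ResolutionOfSingularities.ResolutionOfSingularities.Theorems.PIDim4

namespace LoopC

open StepKit LoopCLocal
open Literature.AlgebraicGeometry.Resolution
open Literature.AlgebraicGeometry.Resolution.CentreBlowup

variable {K : Type} [Field K] [DecidableEq K]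

/-! ## §1 Class-restricted trap tables -/

/-- **Class-restricted in-scope trap checker**: `scopeTrapB` (every permissible coordinate centre answered by a
recorded legal move inside the table; every state in scope) AND every recorded move `(S, j, b, _)` lies in the
reply class `ρ`. [folklore] -/
def classTrapB (q : ℕ) (ρ : Finset (Fin 4) → Fin 4 → (Fin 4 → K) → Bool) (T : ScopeTrapRows K) : Bool :=
  scopeTrapB q T && (rowsOf T).all fun sw => sw.2.all fun m => ρ m.1 m.2.1 m.2.2.1

/-- **LOCAL in-scope trap checker**: the reply class is res-dim4-p-6 g2's `localB` (`bᵢ = 0` off the centre).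
[folklore] -/
def localTrapB (q : ℕ) (T : ScopeTrapRows K) : Bool := classTrapB q localB T

/-- A recorded legal move (`StepKit.moveB`) whose point lies in the class `ρ` is an `RSucc q ρ` edge onto a
state of the table. [folklore] -/
theorem rSucc_of_moveB {q : ℕ} {ρ : Finset (Fin 4) → Fin 4 → (Fin 4 → K) → Bool} {TW : TrapRows K}
    {s : SData 4 K} {m : Move K} (h : moveB q TW s m = true) (hρ : ρ m.1 m.2.1 m.2.2.1 = true) :
    ∃ s' ∈ trapSet TW, RSucc q ρ s.toState m.1 s' := by
  simp only [moveB, Bool.and_eq_true, decide_eq_true_eq, Bool.not_eq_true'] at h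
  obtain ⟨⟨⟨⟨hj, hb⟩, h1⟩, h2⟩, h3⟩ := h
  cases hget : TW[m.2.2.2]? with
  | none => rw [hget] at h3; exact absurd h3 (by simp)
  | some t =>
    rw [hget] at h3
    simp only [Option.elim] at h3
    refine ⟨t.1.toState, mem_trapSet (List.mem_of_getElem? hget), m.2.1, m.2.2.1, hj, hb, hρ,
      (isEquimultiplePoint_iff q m.1 m.2.1 m.2.2.1 s).mpr h1, (step_F_ne_zero_iff q m.1 m.2.1 m.2.2.1 s).mpr h2,
      ((step_eq_iff q m.1 m.2.1 m.2.2.1 s t.1).mpr h3).symm⟩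

/-- **Soundness (trap set)**: a passing class-restricted table presents a `Game.IsTrapSet` of the
`ρ`-restricted in-scope game — every state has a legal move (the point: in scope and `q`-fold) and every legal
centre is answered inside the table by a `ρ`-reply. [folklore] -/
theorem isTrapSet_of_classTrapB {q : ℕ} {ρ : Finset (Fin 4) → Fin 4 → (Fin 4 → K) → Bool}
    {T : ScopeTrapRows K} (h : classTrapB q ρ T = true) :
    Game.IsTrapSet
      (fun (t : State K) (S : Finset (Fin 4)) => InCoordinateScope q t.F ∧ IsPermissibleCentre q S t.F)
      (RSucc q ρ) (trapSet (rowsOf T)) := by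
  have h' := h
  simp only [classTrapB, Bool.and_eq_true, List.all_eq_true] at h'
  obtain ⟨hst, hcls⟩ := h'
  have hsc := inScope_of_mem_trapSet_rowsOf hst
  have htrap : trapB q (rowsOf T) = true := by
    simp only [scopeTrapB, Bool.and_eq_true] at hst; exact hst.1
  rintro x ⟨sw, hsw, rfl⟩
  simp only [trapB, List.all_eq_true, Bool.and_eq_true, decide_eq_true_eq] at htrap
  obtain ⟨hord, hall⟩ := htrap sw hsw
  have hperm : IsPermissibleCentre q Finset.univ sw.1.toState.F := (isPermissibleCentre_iff q _ sw.1.L).mpr hord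
  refine ⟨⟨Finset.univ, hsc _ (mem_trapSet hsw), hperm⟩, fun S hS => ?_⟩
  obtain ⟨m, hm, hmS, hmove⟩ := hall S ((isPermissibleCentre_iff q S sw.1.L).mp hS.2)
  obtain ⟨s', hs', hsucc⟩ := rSucc_of_moveB hmove (hcls sw hsw m hm)
  exact ⟨s', hs', hmS ▸ hsucc⟩

/-- **Soundness (no A-win)**: no state of a passing class-restricted table is an A-win of the `ρ`-restricted
in-scope game (`LoopCLocal.RWins`). [folklore] -/
theorem not_rWins_of_classTrapB {q : ℕ} {ρ : Finset (Fin 4) → Fin 4 → (Fin 4 → K) → Bool}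
    {T : ScopeTrapRows K} (h : classTrapB q ρ T = true) : ∀ s ∈ trapSet (rowsOf T), ¬ RWins q ρ s :=
  fun _ hs hw => Game.Wins.not_mem_of_isTrapSet _ _ (isTrapSet_of_classTrapB h) hw hs

/-- A class-restricted trap is in particular an in-scope trap of the GLOBAL game, so it refutes F4-C of record
`TerminatesInScope p q` over its field. [folklore] -/
theorem not_terminatesInScope_of_classTrapB (p q : ℕ) [CharP K p]
    {ρ : Finset (Fin 4) → Fin 4 → (Fin 4 → K) → Bool} {T : ScopeTrapRows K} (h : classTrapB q ρ T = true)
    (hne : T ≠ []) : ¬ TerminatesInScope p q := by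
  simp only [classTrapB, Bool.and_eq_true] at h
  exact not_terminatesInScope_of_scopeTrapB p q h.1 hne

/-! ## §2 The local game -/

/-- **A passing LOCAL trap table presents a trap set of the LOCAL in-scope game.** [folklore] -/
theorem isTrapSet_of_localTrapB {q : ℕ} {T : ScopeTrapRows K} (h : localTrapB q T = true) :
    Game.IsTrapSet
      (fun (t : State K) (S : Finset (Fin 4)) => InCoordinateScope q t.F ∧ IsPermissibleCentre q S t.F)
      (RSucc q localB) (trapSet (rowsOf T)) :=
  isTrapSet_of_classTrapB h

/-- **No state of a passing LOCAL trap table is an A-win of the LOCAL in-scope game** — the state-level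
negation of local in-scope termination from those states. [folklore] -/
theorem not_rWins_local_of_localTrapB {q : ℕ} {T : ScopeTrapRows K} (h : localTrapB q T = true) :
    ∀ s ∈ trapSet (rowsOf T), ¬ RWins q localB s :=
  not_rWins_of_classTrapB h

/-- … and F4-C of record (`TerminatesInScope p q`, GLOBAL) fails as well over that field. [folklore] -/
theorem not_terminatesInScope_of_localTrapB (p q : ℕ) [CharP K p] {T : ScopeTrapRows K}
    (h : localTrapB q T = true) (hne : T ≠ []) : ¬ TerminatesInScope p q :=
  not_terminatesInScope_of_classTrapB p q h hne

end LoopC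

end Summit.ResolutionOfSingularities.ResolutionOfSingularities.Theorems.PIDim4

end
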